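import Literature.Analysis.FunctionSpaces.TorusSobolevSup
import Literature.MathematicalPhysics.KineticTheory.HardSphereEuler

/-!
# Sup-norm and `C¹` bounds of a smooth field on `𝕋³` from its weighted `L²` energies

Helper file for the line `log-lipschitz-budget` of the crux
`ImplosionDichotomy.PolynomialCompression` (stub `stub_logBudgetShadowing`, §5 "closing" of the
`H³` energy method): the bootstrap compares the difference `δV = (δρ, δu, δθ)` of two classical
solutions in sup norm (`|δρ| ≤ ρ₁/2`, …) and in `C¹` (`|∂ᵢ δu| ≤ C_b/λ`, …), while the energy
method controls the WEIGHTED energies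
`E_k = Σ_{|α| = k} ∫ ½ (A (∂^α δρ)² + ρ ‖∂^α δu‖² + B (∂^α δθ)²)` with smooth positive weights
`ω ∈ {A, ρ, B}` bounded below by explicit `m > 0`. This file turns
weighted energies into pointwise bounds, via the Sobolev embedding `H²(𝕋³) ⊂ L^∞(𝕋³)` of
`Literature.Analysis.FunctionSpaces.TorusSobolevSup` (`Torus.exists_norm_sq_le_sobolev_two`):

* `torus_integral_sq_le_of_le_weight` / `torus_integral_norm_sq_le_of_le_weight` — (M1) weighted
  to plain `L²`: `∫ g² ≤ m⁻¹ ∫ ω g²` for continuous `g` (real- or `V3`-valued) and a continuous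
  weight `ω ≥ m > 0` on `𝕋³`;
* `sup_le_of_weighted_energies` — ONE constant `K > 0` such that, for every continuous weight
  `ω ≥ m > 0` and every smooth `f` on `𝕋³` (real- or `V3`-valued),
  (M3) `‖f x‖² ≤ K m⁻¹ (∫ ω ‖f‖² + Σᵢ ∫ ω ‖∂ᵢ f‖² + Σⱼ Σᵢ ∫ ω ‖∂ⱼ ∂ᵢ f‖²)` and
  (M2) `‖∂ₗ f x‖² ≤ K m⁻¹ (Σ_{l'} ∫ ω ‖∂_{l'} f‖² + Σᵢ Σ_{l'} ∫ ω ‖∂ᵢ ∂_{l'} f‖²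
        + Σⱼ Σᵢ Σ_{l'} ∫ ω ‖∂ⱼ ∂ᵢ ∂_{l'} f‖²)`
  (levels `0–2`, resp. `1–3`, of the energy hierarchy; sums over `Fin 3`, Bochner integrals for
  the probability measure `volume` on `T3 = UnitAddTorus (Fin 3)`, nesting
  `∂ⱼ (∂ᵢ (∂_{l'} f)) = Torus.partialDeriv j (Torus.partialDeriv i (Torus.partialDeriv l' f))`).

Proofs: (M1) is `m ∫ g² = ∫ m g² ≤ ∫ ω g²` (continuous functions on the compact torus are
integrable, `Continuous.integrable_unitAddTorus`); (M3) is the Sobolev bound followed by (M1) on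
each of the `1 + 3 + 9` integrals; (M2) is (M3) for the smooth field `∂ₗ f`
(`Torus.IsSmooth.partialDeriv`) followed by enlarging the single-index terms to the full sums by
nonnegativity. The real-valued statements are the case `F' = ℝ` of the vector-valued ones
(`‖r‖² = r²`). All public statements are in the `∀`-form of their registered signatures.
-/

noncomputable section

namespace Summit.AtomisticToContinuum.HydrodynamicLimit.Theorems

open MeasureTheory
open Literature.MathematicalPhysics.KineticTheory Literature.Analysis.FunctionSpaces

/-! ### (M1) weighted to plain `L²` -/

/-- (M1), general normed target: for a continuous `g : 𝕋³ → F'`, a continuous weight `ω` and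
`0 < m ≤ ω`, `∫ ‖g‖² ≤ m⁻¹ ∫ ω ‖g‖²`. [folklore] -/
private theorem integral_norm_sq_le_of_le_weight_aux {F' : Type*} [NormedAddCommGroup F']
    {g : T3 → F'} {ω : T3 → ℝ} {m : ℝ} (hg : Continuous g) (hω : Continuous ω) (hm : 0 < m)
    (hle : ∀ x, m ≤ ω x) : ∫ x, ‖g x‖ ^ 2 ≤ m⁻¹ * ∫ x, ω x * ‖g x‖ ^ 2 := by
  have hi1 : Integrable (fun x => ‖g x‖ ^ 2) volume := (hg.norm.pow 2).integrable_unitAddTorus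
  have hi2 : Integrable (fun x => ω x * ‖g x‖ ^ 2) volume :=
    (hω.mul (hg.norm.pow 2)).integrable_unitAddTorus
  rw [le_inv_mul_iff₀ hm, ← integral_const_mul]
  exact integral_mono (hi1.const_mul m) hi2 fun x =>
    mul_le_mul_of_nonneg_right (hle x) (sq_nonneg _)

/-- **(M1), real-valued.** For continuous `g, ω : 𝕋³ → ℝ` with `0 < m ≤ ω x` for all `x`,
`∫ g² ≤ m⁻¹ ∫ ω g²` (both integrands are continuous, hence integrable on the compact torus).
[folklore] -/
theorem torus_integral_sq_le_of_le_weight :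
    ∀ {g ω : T3 → ℝ} {m : ℝ}, Continuous g → Continuous ω → 0 < m → (∀ x, m ≤ ω x) →
      ∫ x, g x ^ 2 ≤ m⁻¹ * ∫ x, ω x * g x ^ 2 := by
  intro g ω m hg hω hm hle
  have h := integral_norm_sq_le_of_le_weight_aux hg hω hm hle
  simp only [Real.norm_eq_abs, sq_abs] at h
  exact h

/-- **(M1), vector-valued.** For a continuous `g : 𝕋³ → V3`, a continuous weight `ω : 𝕋³ → ℝ`
and `0 < m ≤ ω x` for all `x`, `∫ ‖g‖² ≤ m⁻¹ ∫ ω ‖g‖²`. [folklore] -/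
theorem torus_integral_norm_sq_le_of_le_weight :
    ∀ {g : T3 → V3} {ω : T3 → ℝ} {m : ℝ}, Continuous g → Continuous ω → 0 < m →
      (∀ x, m ≤ ω x) → ∫ x, ‖g x‖ ^ 2 ≤ m⁻¹ * ∫ x, ω x * ‖g x‖ ^ 2 := by
  intro g ω m hg hω hm hle
  exact integral_norm_sq_le_of_le_weight_aux hg hω hm hle

/-! ### (M3) and (M2) for a general finite-dimensional target, Sobolev constant as a parameter -/

section General

variable {F' : Type*} [NormedAddCommGroup F'] [NormedSpace ℝ F']

/-- (M3) with the Sobolev bound as a hypothesis: if `‖f x‖² ≤ K (∫ ‖f‖² + Σᵢ ∫ ‖∂ᵢ f‖²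
+ Σᵢ Σⱼ ∫ ‖∂ᵢ ∂ⱼ f‖²)` for all smooth `f : 𝕋³ → F'` (with `K ≥ 0`), then for every continuous
weight `ω ≥ m > 0`, `‖f x‖² ≤ K m⁻¹ (∫ ω ‖f‖² + Σᵢ ∫ ω ‖∂ᵢ f‖² + Σⱼ Σᵢ ∫ ω ‖∂ⱼ ∂ᵢ f‖²)`.
[folklore] -/
private theorem norm_sq_le_weighted_aux {K : ℝ} (hK0 : 0 ≤ K)
    (hK : ∀ f : T3 → F', Torus.IsSmooth f → ∀ x,
      ‖f x‖ ^ 2 ≤ K * ((∫ y, ‖f y‖ ^ 2) + (∑ i, ∫ y, ‖Torus.partialDeriv i f y‖ ^ 2) +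
        ∑ i, ∑ j, ∫ y, ‖Torus.partialDeriv i (Torus.partialDeriv j f) y‖ ^ 2))
    {ω : T3 → ℝ} {m : ℝ} (hω : Continuous ω) (hm : 0 < m) (hle : ∀ x, m ≤ ω x)
    {f : T3 → F'} (hf : Torus.IsSmooth f) (x : T3) :
    ‖f x‖ ^ 2 ≤ K * m⁻¹ * ((∫ y, ω y * ‖f y‖ ^ 2) +
      (∑ i, ∫ y, ω y * ‖Torus.partialDeriv i f y‖ ^ 2) +
        ∑ j, ∑ i, ∫ y, ω y * ‖Torus.partialDeriv j (Torus.partialDeriv i f) y‖ ^ 2) := by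
  have h0 : ∫ y, ‖f y‖ ^ 2 ≤ m⁻¹ * ∫ y, ω y * ‖f y‖ ^ 2 :=
    integral_norm_sq_le_of_le_weight_aux hf.continuous hω hm hle
  have h1 : ∀ i, ∫ y, ‖Torus.partialDeriv i f y‖ ^ 2 ≤
      m⁻¹ * ∫ y, ω y * ‖Torus.partialDeriv i f y‖ ^ 2 := fun i =>
    integral_norm_sq_le_of_le_weight_aux (hf.partialDeriv i).continuous hω hm hle
  have h2 : ∀ j i, ∫ y, ‖Torus.partialDeriv j (Torus.partialDeriv i f) y‖ ^ 2 ≤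
      m⁻¹ * ∫ y, ω y * ‖Torus.partialDeriv j (Torus.partialDeriv i f) y‖ ^ 2 := fun j i =>
    integral_norm_sq_le_of_le_weight_aux ((hf.partialDeriv i).partialDeriv j).continuous hω hm hle
  calc ‖f x‖ ^ 2 ≤ K * ((∫ y, ‖f y‖ ^ 2) + (∑ i, ∫ y, ‖Torus.partialDeriv i f y‖ ^ 2) +
        ∑ j, ∑ i, ∫ y, ‖Torus.partialDeriv j (Torus.partialDeriv i f) y‖ ^ 2) := hK f hf x
    _ ≤ K * ((m⁻¹ * ∫ y, ω y * ‖f y‖ ^ 2) +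
        (∑ i, m⁻¹ * ∫ y, ω y * ‖Torus.partialDeriv i f y‖ ^ 2) +
          ∑ j, ∑ i, m⁻¹ * ∫ y, ω y * ‖Torus.partialDeriv j (Torus.partialDeriv i f) y‖ ^ 2) := by
        exact mul_le_mul_of_nonneg_left
          (add_le_add (add_le_add h0 (Finset.sum_le_sum fun i _ => h1 i))
            (Finset.sum_le_sum fun j _ => Finset.sum_le_sum fun i _ => h2 j i)) hK0
    _ = K * m⁻¹ * ((∫ y, ω y * ‖f y‖ ^ 2) +
        (∑ i, ∫ y, ω y * ‖Torus.partialDeriv i f y‖ ^ 2) +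
          ∑ j, ∑ i, ∫ y, ω y * ‖Torus.partialDeriv j (Torus.partialDeriv i f) y‖ ^ 2) := by
        simp only [← Finset.mul_sum]
        ring

/-- (M2) with the Sobolev bound as a hypothesis: under the hypothesis of
`norm_sq_le_weighted_aux`, for every continuous weight `ω ≥ m > 0`, every smooth `f : 𝕋³ → F'`
and every direction `l`, `‖∂ₗ f x‖² ≤ K m⁻¹ (Σ_{l'} ∫ ω ‖∂_{l'} f‖² + Σᵢ Σ_{l'} ∫ ω ‖∂ᵢ ∂_{l'} f‖²
+ Σⱼ Σᵢ Σ_{l'} ∫ ω ‖∂ⱼ ∂ᵢ ∂_{l'} f‖²)` ((M3) for `∂ₗ f`, then single-index terms are bounded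
by the full sums of nonnegative terms). [folklore] -/
private theorem norm_sq_partialDeriv_le_weighted_aux {K : ℝ} (hK0 : 0 ≤ K)
    (hK : ∀ f : T3 → F', Torus.IsSmooth f → ∀ x,
      ‖f x‖ ^ 2 ≤ K * ((∫ y, ‖f y‖ ^ 2) + (∑ i, ∫ y, ‖Torus.partialDeriv i f y‖ ^ 2) +
        ∑ i, ∑ j, ∫ y, ‖Torus.partialDeriv i (Torus.partialDeriv j f) y‖ ^ 2))
    {ω : T3 → ℝ} {m : ℝ} (hω : Continuous ω) (hm : 0 < m) (hle : ∀ x, m ≤ ω x)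
    {f : T3 → F'} (hf : Torus.IsSmooth f) (l : Fin 3) (x : T3) :
    ‖Torus.partialDeriv l f x‖ ^ 2 ≤ K * m⁻¹ *
      ((∑ l', ∫ y, ω y * ‖Torus.partialDeriv l' f y‖ ^ 2) +
        (∑ i, ∑ l', ∫ y, ω y * ‖Torus.partialDeriv i (Torus.partialDeriv l' f) y‖ ^ 2) +
          ∑ j, ∑ i, ∑ l', ∫ y, ω y *
            ‖Torus.partialDeriv j (Torus.partialDeriv i (Torus.partialDeriv l' f)) y‖ ^ 2) := by
  have hωm : ∀ y, 0 ≤ ω y := fun y => hm.le.trans (hle y)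
  have hKm : 0 ≤ K * m⁻¹ := mul_nonneg hK0 (inv_nonneg.2 hm.le)
  -- (M3) for the smooth field `∂ₗ f`
  have h := norm_sq_le_weighted_aux hK0 hK hω hm hle (hf.partialDeriv l) x
  refine h.trans (mul_le_mul_of_nonneg_left ?_ hKm)
  -- enlarge single-index terms to full sums
  have e0 : ∫ y, ω y * ‖Torus.partialDeriv l f y‖ ^ 2 ≤
      ∑ l', ∫ y, ω y * ‖Torus.partialDeriv l' f y‖ ^ 2 :=
    Finset.single_le_sum (f := fun l' => ∫ y, ω y * ‖Torus.partialDeriv l' f y‖ ^ 2)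
      (fun l' _ => integral_nonneg fun y => mul_nonneg (hωm y) (sq_nonneg _)) (Finset.mem_univ l)
  have e1 : ∑ i, ∫ y, ω y * ‖Torus.partialDeriv i (Torus.partialDeriv l f) y‖ ^ 2 ≤
      ∑ i, ∑ l', ∫ y, ω y * ‖Torus.partialDeriv i (Torus.partialDeriv l' f) y‖ ^ 2 :=
    Finset.sum_le_sum fun i _ =>
      Finset.single_le_sum
        (f := fun l' => ∫ y, ω y * ‖Torus.partialDeriv i (Torus.partialDeriv l' f) y‖ ^ 2)
        (fun l' _ => integral_nonneg fun y => mul_nonneg (hωm y) (sq_nonneg _)) (Finset.mem_univ l)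
  have e2 : ∑ j, ∑ i, ∫ y, ω y *
        ‖Torus.partialDeriv j (Torus.partialDeriv i (Torus.partialDeriv l f)) y‖ ^ 2 ≤
      ∑ j, ∑ i, ∑ l', ∫ y, ω y *
        ‖Torus.partialDeriv j (Torus.partialDeriv i (Torus.partialDeriv l' f)) y‖ ^ 2 :=
    Finset.sum_le_sum fun j _ => Finset.sum_le_sum fun i _ =>
      Finset.single_le_sum
        (f := fun l' => ∫ y, ω y *
          ‖Torus.partialDeriv j (Torus.partialDeriv i (Torus.partialDeriv l' f)) y‖ ^ 2)
        (fun l' _ => integral_nonneg fun y => mul_nonneg (hωm y) (sq_nonneg _)) (Finset.mem_univ l)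
  exact add_le_add (add_le_add e0 e1) e2

end General

/-! ### The Sobolev constant, common to real- and `V3`-valued fields -/

/-- One constant `K > 0` for which the `H² ⊂ L^∞` bound of `Torus.exists_norm_sq_le_sobolev_two`
holds both for real-valued and for `V3`-valued smooth fields on `𝕋³` (the maximum of the two
constants; the bracket is nonnegative). [folklore] -/
private theorem exists_common_sobolev_constant :
    ∃ K : ℝ, 0 < K ∧
      (∀ f : T3 → ℝ, Torus.IsSmooth f → ∀ x,
        ‖f x‖ ^ 2 ≤ K * ((∫ y, ‖f y‖ ^ 2) + (∑ i, ∫ y, ‖Torus.partialDeriv i f y‖ ^ 2) +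
          ∑ i, ∑ j, ∫ y, ‖Torus.partialDeriv i (Torus.partialDeriv j f) y‖ ^ 2)) ∧
      (∀ f : T3 → V3, Torus.IsSmooth f → ∀ x,
        ‖f x‖ ^ 2 ≤ K * ((∫ y, ‖f y‖ ^ 2) + (∑ i, ∫ y, ‖Torus.partialDeriv i f y‖ ^ 2) +
          ∑ i, ∑ j, ∫ y, ‖Torus.partialDeriv i (Torus.partialDeriv j f) y‖ ^ 2)) := by
  obtain ⟨K₁, hK₁, h₁⟩ := Torus.exists_norm_sq_le_sobolev_two ℝ
  obtain ⟨K₂, hK₂, h₂⟩ := Torus.exists_norm_sq_le_sobolev_two V3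
  refine ⟨max K₁ K₂, lt_max_of_lt_left hK₁, fun f hf x => ?_, fun f hf x => ?_⟩
  · refine (h₁ f hf x).trans (mul_le_mul_of_nonneg_right (le_max_left _ _) ?_)
    positivity
  · refine (h₂ f hf x).trans (mul_le_mul_of_nonneg_right (le_max_right _ _) ?_)
    positivity

/-! ### (M3) + (M2): the registered statement -/

/-- **Sup and `C¹` bounds from weighted energies (`H²(𝕋³) ⊂ L^∞`).** There is ONE constant
`K > 0` such that for every continuous weight `ω : 𝕋³ → ℝ` with `0 < m ≤ ω x` for all `x`:
(M3, real) every smooth `f : 𝕋³ → ℝ` satisfies, at every `x`,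
`f x² ≤ K m⁻¹ (∫ ω f² + Σᵢ ∫ ω (∂ᵢ f)² + Σⱼ Σᵢ ∫ ω (∂ⱼ ∂ᵢ f)²)`;
(M3, vector) every smooth `f : 𝕋³ → V3` satisfies
`‖f x‖² ≤ K m⁻¹ (∫ ω ‖f‖² + Σᵢ ∫ ω ‖∂ᵢ f‖² + Σⱼ Σᵢ ∫ ω ‖∂ⱼ ∂ᵢ f‖²)`;
(M2, real) every smooth `f : 𝕋³ → ℝ` and direction `l` satisfy
`(∂ₗ f x)² ≤ K m⁻¹ (Σ_{l'} ∫ ω (∂_{l'} f)² + Σᵢ Σ_{l'} ∫ ω (∂ᵢ ∂_{l'} f)²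
  + Σⱼ Σᵢ Σ_{l'} ∫ ω (∂ⱼ ∂ᵢ ∂_{l'} f)²)`;
(M2, vector) the same with norms for smooth `f : 𝕋³ → V3`.
Sobolev `H² ⊂ L^∞` on `𝕋³` (Adams 1975, Thm. 5.4 Part I Case C, through
`Torus.exists_norm_sq_le_sobolev_two`), then (M1) on each integral; for (M2) applied to the smooth
field `∂ₗ f` and enlarged to full index sums by nonnegativity. [folklore] -/
theorem sup_le_of_weighted_energies :
    ∃ K : ℝ, 0 < K ∧
      (∀ {ω : T3 → ℝ} {m : ℝ}, Continuous ω → 0 < m → (∀ x, m ≤ ω x) →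
        ∀ {f : T3 → ℝ}, Torus.IsSmooth f → ∀ x : T3,
          f x ^ 2 ≤ K * m⁻¹ * ((∫ y, ω y * f y ^ 2) +
            (∑ i, ∫ y, ω y * Torus.partialDeriv i f y ^ 2) +
              ∑ j, ∑ i, ∫ y, ω y * Torus.partialDeriv j (Torus.partialDeriv i f) y ^ 2)) ∧
      (∀ {ω : T3 → ℝ} {m : ℝ}, Continuous ω → 0 < m → (∀ x, m ≤ ω x) →
        ∀ {f : T3 → V3}, Torus.IsSmooth f → ∀ x : T3,
          ‖f x‖ ^ 2 ≤ K * m⁻¹ * ((∫ y, ω y * ‖f y‖ ^ 2) +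
            (∑ i, ∫ y, ω y * ‖Torus.partialDeriv i f y‖ ^ 2) +
              ∑ j, ∑ i, ∫ y, ω y * ‖Torus.partialDeriv j (Torus.partialDeriv i f) y‖ ^ 2)) ∧
      (∀ {ω : T3 → ℝ} {m : ℝ}, Continuous ω → 0 < m → (∀ x, m ≤ ω x) →
        ∀ {f : T3 → ℝ}, Torus.IsSmooth f → ∀ (l : Fin 3) (x : T3),
          Torus.partialDeriv l f x ^ 2 ≤ K * m⁻¹ *
            ((∑ l', ∫ y, ω y * Torus.partialDeriv l' f y ^ 2) +
              (∑ i, ∑ l', ∫ y, ω y * Torus.partialDeriv i (Torus.partialDeriv l' f) y ^ 2) +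
                ∑ j, ∑ i, ∑ l', ∫ y, ω y *
                  Torus.partialDeriv j (Torus.partialDeriv i (Torus.partialDeriv l' f)) y ^ 2)) ∧
      (∀ {ω : T3 → ℝ} {m : ℝ}, Continuous ω → 0 < m → (∀ x, m ≤ ω x) →
        ∀ {f : T3 → V3}, Torus.IsSmooth f → ∀ (l : Fin 3) (x : T3),
          ‖Torus.partialDeriv l f x‖ ^ 2 ≤ K * m⁻¹ *
            ((∑ l', ∫ y, ω y * ‖Torus.partialDeriv l' f y‖ ^ 2) +
              (∑ i, ∑ l', ∫ y, ω y * ‖Torus.partialDeriv i (Torus.partialDeriv l' f) y‖ ^ 2) +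
                ∑ j, ∑ i, ∑ l', ∫ y, ω y *
                  ‖Torus.partialDeriv j
                    (Torus.partialDeriv i (Torus.partialDeriv l' f)) y‖ ^ 2)) := by
  obtain ⟨K, hK, hℝ, hV⟩ := exists_common_sobolev_constant
  refine ⟨K, hK, ?_, ?_, ?_, ?_⟩
  · intro ω m hω hm hle f hf x
    have h := norm_sq_le_weighted_aux hK.le hℝ hω hm hle hf x
    simp only [Real.norm_eq_abs, sq_abs] at h
    exact h
  · intro ω m hω hm hle f hf x
    exact norm_sq_le_weighted_aux hK.le hV hω hm hle hf x
  · intro ω m hω hm hle f hf l x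
    have h := norm_sq_partialDeriv_le_weighted_aux hK.le hℝ hω hm hle hf l x
    simp only [Real.norm_eq_abs, sq_abs] at h
    exact h
  · intro ω m hω hm hle f hf l x
    exact norm_sq_partialDeriv_le_weighted_aux hK.le hV hω hm hle hf l x

end Summit.AtomisticToContinuum.HydrodynamicLimit.Theorems

end
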